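import Mathlib
import Summits.NavierStokesRegularity.NavierStokesRegularity.Theorems.TaoLadderRungTwoBreakOneShiftWindowKrawczyk
import HarnessLib

/-!
# The one-shift window system, VII: the contraction hypothesis (K1) of the Krawczyk clauses from a DERIVATIVE BOUND
# (mean value inequality) (cell harvest/h2-tao-ladder, seat p2; rung1/RUNG1-P2G10-REPORT.md §43/§46;
# support for K1(1) = `NoSurvivingDSSOne`, stmt-NavierStokesRegularity-20205)

MODEL lattice ODEs only (Tao 2016 §4 normal form on Tao's shift set `S`); nothing here is a statement about
the Navier–Stokes equations; no item is closed; nothing numerical is proved.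

Part V (…OneShiftWindowKrawczyk) reduced the clauses `hwinIn` / `hWedge` to (K1)–(K3); (K1) is the contraction
`|(ξ_u − ξ_v) − (P u − P v)|_∞ ≤ Z · dist(u, v)` of the scaled preconditioned residual `P` in the window point
at FROZEN tails. This is how a C¹ replay delivers it: for each admissible tail part `t`, the map
`K_t : ξ ↦ ξ − P(ξ, t)` on the scaled window space `WState × ℝ` (sup norms; the unit ball IS the unit box) is
differentiable within the closed unit ball with a derivative of operator norm `≤ Z` — in matrix terms
`‖I − S⁻¹·C·DG(ŷ + Sξ; t)·S‖_∞ ≤ Z` — and the mean value inequality on the convex ball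
(`Convex.norm_image_sub_le_of_norm_hasFDerivWithin_le`) gives (K1).

* `pointOf t ξ` (the point of trajectory space with window part `ξ` and tails `t`), `winPart u = (u.1, u.2.1)`;
* `krawczykMap … C t` = `ξ ↦ ξ − P(pointOf t ξ)`;
* `K1_of_fderiv` — (K1) in exactly the form consumed by `krawczyk_winIn` / `krawczyk_wedge`, from
  `HasFDerivWithinAt (krawczykMap t) (L t ξ) (closedBall 0 1) ξ` and `‖L t ξ‖ ≤ Z` on the ball.
-/

noncomputable section

-- the sub-problem namespace repeats the summit name by design (D-0017)
set_option linter.dupNamespace false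

namespace Summit.NavierStokesRegularity.NavierStokesRegularity.Theorems

namespace DSSOneShift

open Set Metric Literature.Analysis.FluidPDE Literature.Analysis.FluidPDE.TaoCascade CertificateGlueOn

variable {m : ℕ}

namespace OneShiftFrame

variable (F : OneShiftFrame m)

/-- The window part (scaled window start, scaled flight time) of a point of trajectory space. [folklore] -/
def winPart (u : F.Space) : F.WState × ℝ := (u.1, u.2.1)

/-- The point of trajectory space with window part `ξ` and tail part `t`. [folklore] -/
def pointOf (t : lp (fun _ : F.TailIdx => ℝ) ⊤) (ξ : F.WState × ℝ) : F.Space := (ξ.1, ξ.2, t)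

/-- `pointOf` inverts `winPart` at fixed tails. [folklore] -/
theorem pointOf_winPart (u : F.Space) : F.pointOf u.2.2 (F.winPart u) = u := rfl

/-- **The scaled Krawczyk map at frozen tails**: `ξ ↦ ξ − P(ξ, t)`. [cite: Tao2016AveragedNS, §5.3; cell vocabulary, harvest/h2-tao-ladder rung1/STAGE2-LEMMA.md §2 (N = x − C·G in scaled coordinates)] -/
def krawczykMap (ε₀ : ℝ) (α : Fin m → Fin m → Fin m → ℤ × ℤ × ℤ → ℝ) (C : F.WState × ℝ → F.WState × ℝ)
    (t : lp (fun _ : F.TailIdx => ℝ) ⊤) (ξ : F.WState × ℝ) : F.WState × ℝ :=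
  ξ - F.precondResidual ε₀ α C (F.pointOf t ξ)

/-- The window part of an admissible point lies in the closed unit ball (= the unit box in the sup norms). [folklore] -/
theorem winPart_mem_closedBall {R : ℤ → ℝ} {u : F.Space} (hu : F.AdmLip R u) :
    F.winPart u ∈ closedBall (0 : F.WState × ℝ) 1 := by
  rw [mem_closedBall_zero_iff, winPart, Prod.norm_def]
  refine max_le ?_ ?_
  · exact (pi_norm_le_iff_of_nonneg zero_le_one).2 fun i =>
      (pi_norm_le_iff_of_nonneg zero_le_one).2 fun k => by rw [Real.norm_eq_abs]; exact hu.1.1 i k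
  · rw [Real.norm_eq_abs]; exact hu.1.2.1

/-- The norm of the window-part difference is at most the distance in trajectory space. [folklore] -/
theorem norm_winPart_sub_le (u v : F.Space) : ‖F.winPart u - F.winPart v‖ ≤ dist u v := by
  rw [← dist_eq_norm, winPart, winPart, Prod.dist_eq, Prod.dist_eq, Prod.dist_eq]
  exact max_le (le_max_left _ _) ((le_max_left _ _).trans (le_max_right _ _))

/-- **(K1) FROM A DERIVATIVE BOUND.** If, for every tail part `t` of an `AdmLip` point, the scaled Krawczyk map
`ξ ↦ ξ − P(ξ, t)` has within the closed unit ball a derivative of operator norm `≤ Z` at every point of the ball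
(what `‖I − S⁻¹ C [DG] S‖_∞ ≤ Z` over the box says), then (K1) holds: at frozen tails,
`|(ξ_u − ξ_v) − (P u − P v)|_∞ ≤ Z · dist(u, v)` coordinatewise — the hypothesis `K1` of `krawczyk_winIn` /
`krawczyk_wedge`. Mean value inequality on the convex unit ball.
[cite: Tao2016AveragedNS, §5.3; cell vocabulary, harvest/h2-tao-ladder rung1/STAGE2-LEMMA.md §2–§3 (‖I − C·DG(X)‖ ≤ Z), rung1/RUNG1-P2G10-REPORT.md §43] -/
theorem K1_of_fderiv {ε₀ : ℝ} {α : Fin m → Fin m → Fin m → ℤ × ℤ × ℤ → ℝ} (C : F.WState × ℝ → F.WState × ℝ)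
    (R : ℤ → ℝ) {Z : ℝ} {L : lp (fun _ : F.TailIdx => ℝ) ⊤ → F.WState × ℝ → (F.WState × ℝ) →L[ℝ] (F.WState × ℝ)}
    (hderiv : ∀ u, F.AdmLip R u → ∀ ξ ∈ closedBall (0 : F.WState × ℝ) 1,
      HasFDerivWithinAt (F.krawczykMap ε₀ α C u.2.2) (L u.2.2 ξ) (closedBall (0 : F.WState × ℝ) 1) ξ)
    (hbound : ∀ u, F.AdmLip R u → ∀ ξ ∈ closedBall (0 : F.WState × ℝ) 1, ‖L u.2.2 ξ‖ ≤ Z) :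
    ∀ u v, F.AdmLip R u → F.AdmLip R v → u.2.2 = v.2.2 →
      (∀ i j, |(u.1 i j - v.1 i j) -
        ((F.precondResidual ε₀ α C u).1 i j - (F.precondResidual ε₀ α C v).1 i j)| ≤ Z * dist u v) ∧
      |(u.2.1 - v.2.1) - ((F.precondResidual ε₀ α C u).2 - (F.precondResidual ε₀ α C v).2)| ≤ Z * dist u v := by
  intro u v hu hv huv
  have hxs := F.winPart_mem_closedBall hu
  have hys := F.winPart_mem_closedBall hv
  -- the mean value inequality for the Krawczyk map at the common tails `u.2.2`
  have hMV := (convex_closedBall (0 : F.WState × ℝ) 1).norm_image_sub_le_of_norm_hasFDerivWithin_le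
    (f := F.krawczykMap ε₀ α C u.2.2) (hderiv u hu) (hbound u hu) hys hxs
  -- identify the values of the Krawczyk map at the two window parts
  have hu' : F.krawczykMap ε₀ α C u.2.2 (F.winPart u) = F.winPart u - F.precondResidual ε₀ α C u := by
    rw [krawczykMap, pointOf_winPart]
  have hv' : F.krawczykMap ε₀ α C u.2.2 (F.winPart v) = F.winPart v - F.precondResidual ε₀ α C v := by
    rw [krawczykMap, huv, pointOf_winPart]
  rw [hu', hv'] at hMV
  have hd : ‖F.winPart u - F.winPart v‖ ≤ dist u v := F.norm_winPart_sub_le u v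
  have hZ : 0 ≤ Z := (norm_nonneg _).trans (hbound u hu _ hxs)
  have hkey : ‖(F.winPart u - F.precondResidual ε₀ α C u) - (F.winPart v - F.precondResidual ε₀ α C v)‖ ≤
      Z * dist u v := hMV.trans (mul_le_mul_of_nonneg_left hd hZ)
  -- read off the coordinates (sup norms)
  set D := (F.winPart u - F.precondResidual ε₀ α C u) - (F.winPart v - F.precondResidual ε₀ α C v) with hD
  have h1 : ‖D.1‖ ≤ Z * dist u v := (norm_fst_le D).trans hkey
  have h2 : ‖D.2‖ ≤ Z * dist u v := (norm_snd_le D).trans hkey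
  refine ⟨fun i j => ?_, ?_⟩
  · have h3 : ‖D.1 i j‖ ≤ Z * dist u v := ((norm_le_pi_norm (D.1 i) j).trans (norm_le_pi_norm D.1 i)).trans h1
    rw [Real.norm_eq_abs] at h3
    have e : D.1 i j = (u.1 i j - v.1 i j) -
        ((F.precondResidual ε₀ α C u).1 i j - (F.precondResidual ε₀ α C v).1 i j) := by
      simp only [hD, winPart, Prod.fst_sub, Pi.sub_apply]; ring
    rwa [e] at h3
  · rw [Real.norm_eq_abs] at h2
    have e : D.2 = (u.2.1 - v.2.1) - ((F.precondResidual ε₀ α C u).2 - (F.precondResidual ε₀ α C v).2) := by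
      simp only [hD, winPart, Prod.snd_sub]; ring
    rwa [e] at h2

end OneShiftFrame

end DSSOneShift

end Summit.NavierStokesRegularity.NavierStokesRegularity.Theorems
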